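import Summits.Ventures.HodgeRepro2.T5SU11JacobiOrbitAngleLaw
import Summits.Ventures.HodgeRepro2.T5SU11JacobiOrbitRadialCheck
import Summits.Ventures.HodgeRepro2.T5SU11JacobiOrbitMomentsVanish
import Summits.Ventures.HodgeRepro2.T5SU11JacobiThreeFour

/-!
# The weight-`3` dossier, IV: the law of the orbit point at the owner's weight `k = 3`

The fourth dossier specialises the orbit-point chapter (`T5SU11JacobiOrbitRotationLaw` …
`T5SU11JacobiOrbitAngleLaw`) to `k = 3`, on the strip `−1 < λ < 3`, for the probability measure
`m_3 φ_λ dν/m̂_3(λ)` of the explicit model `π₃⁺`: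

* the law of `g·0` is rotation-invariant (`orbit_rot_three`), its non-radial moments vanish
  (`orbit_pow_three_eq_zero`), the angle is uniform and independent of the radius
  (`expectation_angle_three`, `expectation_angle_mul_radial_three`);
* the area density on the disc is `(1 − |z|²)^{−1/2} Φ_λ(−½ log(1 − |z|²))/m̂_3(λ)`
  (`integral_orbit_mul_eq_ball_three`), the radial density on `(0, 1)` is
  `π (1 − t)^{−1/2} Φ_λ(−½ log(1 − t))/m̂_3(λ)` (`integral_orbit_sq_tail_three`), with
  `m̂_3(λ) = 2π(1 − λ)/cos(πλ/2)` for `λ ≠ 1`;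
* at `λ = 0` (`m̂_3(0) = 2π`): the orbit point has the density `(1/2π)(1 − |z|²)^{−1/2}` on the disc
  (`orbit_density_three_zero`), the squared radius the density `½(1 − t)^{−1/2}` on `(0, 1)`
  (`orbit_sq_tail_three_zero`: `P_{3,0}(|g·0|² > y) = √(1 − y)`, re-derived), and
  `∫_{|z|<1} (1 − |z|²)^{−1/2} dA = 2π` (`integral_ball_three`).

Nothing is claimed about (N).

Blind lane: Mathlib + the HodgeRepro2 prefix only; no sorry; axioms ⊆ {propext, Classical.choice,
Quot.sound}.
-/

namespace Summit.Ventures.HodgeRepro2.T5SU11WeightThreeDossierIV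

open MeasureTheory MeasureTheory.Measure Metric Set Filter Topology
open T5SU11Unimodular T5SU11Fibration T5SU11Cartan T5HaarCircle T5BergmanCoefficient
  T5SU11FibrationHaar T5SU11SphericalFunction T5SU11SphericalSymmetry T5SU11SphericalBounds
  T5SU11SphericalContinuous T5SU11JacobiIwasawa T5SU11JacobiTransform T5SU11JacobiWeight
  T5SU11KFiniteMajorantPow T5SU11JacobiLaplacePhase T5SU11JacobiOrbitRotationLaw
  T5SU11JacobiOrbitMomentsVanish T5SU11JacobiOrbitDiscLaw T5SU11JacobiOrbitRadialLaw
  T5SU11JacobiOrbitRadialCheck T5SU11JacobiOrbitAngleLaw T5SU11JacobiThreeFour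
open scoped Real

section measure

variable [MeasurableSpace Circle] [BorelSpace Circle]

/-- Rotation invariance at `k = 3`. -/
theorem orbit_rot_three (lam θ : ℝ) {A : Set ℂ} (hA : MeasurableSet A) :
    ∫ g in {g : SU11 | Complex.exp (θ * Complex.I) * orbit g ∈ A},
        (1 - ‖orbit g‖ ^ 2) ^ ((3 : ℝ) / 2) * sph lam g ∂(nu haarCircle)
      = ∫ g in {g : SU11 | orbit g ∈ A}, (1 - ‖orbit g‖ ^ 2) ^ ((3 : ℝ) / 2) * sph lam g ∂(nu haarCircle) :=
  integral_orbit_rot_eq 3 lam θ hA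

/-- The non-radial moments vanish at `k = 3`. -/
theorem orbit_pow_three_eq_zero (lam : ℝ) {n : ℕ} (hn : 0 < n) :
    ∫ g, orbit g ^ n * (((1 - ‖orbit g‖ ^ 2) ^ ((3 : ℝ) / 2) * sph lam g : ℝ) : ℂ) ∂(nu haarCircle) = 0 :=
  integral_orbit_pow_mul_eq_zero 3 lam hn

/-- The angle is uniform at `k = 3`, on `−1 < λ < 3`. -/
theorem expectation_angle_three {h : ℝ → ℝ} (hh : Measurable h) {lam : ℝ} (h1 : -1 < lam) (h2 : lam < 3) :
    (∫ g, h (Complex.arg (orbit g)) * ((1 - ‖orbit g‖ ^ 2) ^ ((3 : ℝ) / 2) * sph lam g) ∂(nu haarCircle))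
        / ∫ g, (1 - ‖orbit g‖ ^ 2) ^ ((3 : ℝ) / 2) * sph lam g ∂(nu haarCircle)
      = (∫ θ in Ioo (-π) π, h θ) / (2 * π) :=
  expectation_angle_eq hh (by norm_num) h2 (by linarith)

/-- The angle and the radius are independent at `k = 3`, on `−1 < λ < 3`. -/
theorem expectation_angle_mul_radial_three {h ψ : ℝ → ℝ} (hh : Measurable h) (hψ : Measurable ψ)
    {lam : ℝ} (h1 : -1 < lam) (h2 : lam < 3) :
    (∫ g, h (Complex.arg (orbit g)) * ψ ‖orbit g‖ * ((1 - ‖orbit g‖ ^ 2) ^ ((3 : ℝ) / 2) * sph lam g)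
        ∂(nu haarCircle)) / ∫ g, (1 - ‖orbit g‖ ^ 2) ^ ((3 : ℝ) / 2) * sph lam g ∂(nu haarCircle)
      = ((∫ g, h (Complex.arg (orbit g)) * ((1 - ‖orbit g‖ ^ 2) ^ ((3 : ℝ) / 2) * sph lam g) ∂(nu haarCircle))
          / ∫ g, (1 - ‖orbit g‖ ^ 2) ^ ((3 : ℝ) / 2) * sph lam g ∂(nu haarCircle))
        * ((∫ g, ψ ‖orbit g‖ * ((1 - ‖orbit g‖ ^ 2) ^ ((3 : ℝ) / 2) * sph lam g) ∂(nu haarCircle))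
          / ∫ g, (1 - ‖orbit g‖ ^ 2) ^ ((3 : ℝ) / 2) * sph lam g ∂(nu haarCircle)) :=
  expectation_angle_mul_radial_eq hh hψ (by norm_num) h2 (by linarith)

/-- **The area density at `k = 3`**: `∫_G F(g·0) m_3 φ_λ dν = ∫_{|z|<1} F(z) (1 − |z|²)^{−1/2} Φ_λ(−½ log(1 − |z|²)) dA`. -/
theorem integral_orbit_mul_eq_ball_three {F : ℂ → ℝ} (hF : Measurable F) (lam : ℝ) :
    ∫ g, F (orbit g) * ((1 - ‖orbit g‖ ^ 2) ^ ((3 : ℝ) / 2) * sph lam g) ∂(nu haarCircle)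
      = ∫ z in ball (0 : ℂ) 1,
          F z * ((1 - ‖z‖ ^ 2) ^ (-(1 / 2 : ℝ)) * sphPhase lam (-(1 / 2) * Real.log (1 - ‖z‖ ^ 2))) := by
  rw [integral_orbit_mul_eq_ball hF 3 lam]
  norm_num

/-- **The radial density at `k = 3`**: for `−1 < λ < 3`, `0 ≤ y < 1`,
`∫_{|g·0|² > y} m_3 φ_λ dν = π ∫_y^1 (1 − t)^{−1/2} Φ_λ(−½ log(1 − t)) dt`. -/
theorem integral_orbit_sq_tail_three {lam : ℝ} (h1 : -1 < lam) (h2 : lam < 3) {y : ℝ} (hy0 : 0 ≤ y)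
    (hy1 : y < 1) :
    ∫ g in {g : SU11 | y < ‖orbit g‖ ^ 2}, (1 - ‖orbit g‖ ^ 2) ^ ((3 : ℝ) / 2) * sph lam g ∂(nu haarCircle)
      = π * ∫ t in Ioo y 1, (1 - t) ^ (-(1 / 2 : ℝ)) * sphPhase lam (-(1 / 2) * Real.log (1 - t)) := by
  rw [integral_orbit_sq_tail_eq (by norm_num) h2 (by linarith) hy0 hy1]
  norm_num

/-! ### `λ = 0` at `k = 3` -/

/-- `∫_{|z|<1} (1 − |z|²)^{−1/2} dA = 2π`. -/
theorem integral_ball_three : ∫ z in ball (0 : ℂ) 1, (1 - ‖z‖ ^ 2) ^ (-(1 / 2 : ℝ)) = 2 * π := by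
  have h := integral_ball_one_sub_normSq_rpow (k := 3) (by norm_num)
  norm_num at h
  exact h

/-- **The orbit point of `π₃⁺` at `λ = 0` has the density `(1/2π)(1 − |z|²)^{−1/2}` on the disc**:
`E_{3,0}[F(g·0)] = (1/2π) ∫_{|z|<1} F(z) (1 − |z|²)^{−1/2} dA`. -/
theorem orbit_density_three_zero {F : ℂ → ℝ} (hF : Measurable F) :
    (∫ g, F (orbit g) * ((1 - ‖orbit g‖ ^ 2) ^ ((3 : ℝ) / 2) * sph 0 g) ∂(nu haarCircle))
        / ∫ g, (1 - ‖orbit g‖ ^ 2) ^ ((3 : ℝ) / 2) * sph 0 g ∂(nu haarCircle)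
      = (∫ z in ball (0 : ℂ) 1, F z * (1 - ‖z‖ ^ 2) ^ (-(1 / 2 : ℝ))) / (2 * π) := by
  rw [integral_orbit_mul_eq_ball_three hF 0, integral_orbit_rpow_mul_sph_zero (by norm_num)]
  simp only [sphPhase_lam_zero, mul_one]
  norm_num

/-- **`P_{3,0}(|g·0|² > y) = √(1 − y)`**, re-derived through the radial density. -/
theorem orbit_sq_tail_three_zero {y : ℝ} (hy0 : 0 ≤ y) (hy1 : y < 1) :
    (∫ g in {g : SU11 | y < ‖orbit g‖ ^ 2}, (1 - ‖orbit g‖ ^ 2) ^ ((3 : ℝ) / 2) * sph 0 g ∂(nu haarCircle))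
        / ∫ g, (1 - ‖orbit g‖ ^ 2) ^ ((3 : ℝ) / 2) * sph 0 g ∂(nu haarCircle)
      = Real.sqrt (1 - y) := by
  rw [orbit_sq_tail_prob_zero (by norm_num) hy0 hy1, Real.sqrt_eq_rpow]
  norm_num

end measure

end Summit.Ventures.HodgeRepro2.T5SU11WeightThreeDossierIV
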